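import Summits.Ventures.CertifiedQuantumChemistry.Hamiltonians.HubbardRingTV
import Summits.Ventures.CertifiedQuantumChemistry.Rows.RelaxationValueConcavity
import Literature.MathematicalPhysics.QuantumLattice.GriffithsLemmaGroundStates
import HarnessLib

/-!
# Ventures/CertifiedQuantumChemistry — Rows/SectorEnergyConcavity.lean: the exact sector energy `E₀` is
# concave and Lipschitz along lines in table space; on the Hubbard-ring files `E₀(L;U)`, `OPT_DQG(L;U)`,
# `OPT_DQG+S²(L;U)` are concave functions of `U`

HONEST FRAMING (verbatim): certified bounds for a stated model Hamiltonian in a stated basis; not a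
claim about the real molecule beyond that model.

Seat rdm-B (gen 21), ROWS file: theorems only (no `def`, no notation), zero compute, nothing landed is
touched; the typer's adopt / refactor / retire word applies. Companion of `Rows/RelaxationValueConcavity.lean`
(the two-positivity VALUES are concave / Lipschitz along lines `T₀ + sT₁`); this file adds the EXACT side
and the identification on the cell's Hubbard-ring model `Hamiltonians.hubbardRingTV L t U`
(STRUCTURE §2 (S-U) scope note / Q1 / 2.1 (d), words-only input):

* §1 `molecularHamiltonian_line` — `Ĥ(T₀ + sT₁) = Ĥ(T₀) + s·Ĥ(T₁)` (the second-quantised map is linear in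
  the tables).
* §2 `concaveOn_minEnergyOn_line`, `abs_minEnergyOn_sub_le` — for ANY subspace `K` containing a unit
  vector, `s ↦ minEnergyOn (H₀ + sH₁) K` is concave on `ℝ` (an infimum of affine functions — the
  variational principle) and `|minEnergyOn H K − minEnergyOn H′ K| ≤ Σ_st ‖H_st − H′_st‖`.
* §3 **`concaveOn_sectorGroundEnergy_line`** — `s ↦ E₀(Ĥ(T₀ + sT₁); a, b)` is concave (`a, b ≤ |Λ|`);
  `abs_sectorGroundEnergy_sub_le`.
* §4 THE HUBBARD-RING PENCIL IN `U`: `hubbardRingTV_h_pencil`, `hubbardRingTV_eri_pencil`,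
  `hubbardRingTV_ecore_pencil`, `hubbardRingTV_tables_pencil`, **`hubbardRingTV_hamiltonian_pencil`**
  (`Ĥ(L; t, U) = Ĥ(L; t, 0) + U·Ĥ(L; 0, 1)`: hopping plus `U` times the on-site repulsion, as models),
  `hubbardRingTV_energy_eq_pencil`; **`concaveOn_hubbardRing_energy`** (`U ↦ E₀(L; t, U; a, b)` is the
  restriction to `ℚ` of a concave function on `ℝ` — the tree's Griffiths-lemma `concaveOn_minEnergyOn_pencil`
  on the two Hermitian model Hamiltonians), `abs_hubbardRing_energy_sub_le` (Lipschitz in `U`),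
  **`concaveOn_hubbardRing_pqgSectorEnergy`**, **`concaveOn_hubbardRing_pqgSingletEnergy`** (`U ↦ OPT_DQG`,
  `U ↦ OPT_DQG+S²` along the same pencil, from `Rows/RelaxationValueConcavity`). So every certified gap
  `Ĝ_X(L;U) = E₀ − OPT_X` of STRUCTURE §1A is a DIFFERENCE of two concave, Lipschitz functions of `U`
  (no sign or monotonicity claim follows from that alone — NOT claimed).

Everything is PROVED (0 sorry, standard axioms); no definitions, no named facts; nothing asserts a bound
about any model; no claim node / hint / row / CERTIFIED cell depends on it.

References: E. H. Lieb, Phys. Rev. Lett. 62 (1989) 1201 (work in a sector; variational characterisation);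
H. Tasaki, *Physics and Mathematics of Quantum Many-Body Systems* (Springer 2020) §2.1 (2.1.6) (min–max);
R. T. Rockafellar, *Convex Analysis* (1970) Thm 5.5 (infimum of affine functions is concave); M. Nakata et
al., J. Chem. Phys. 128 (2008) 164113 §II.A. Tree (REUSED): `molecularHamiltonian`, `sectorGroundEnergy(_def)`,
`Matrix.minEnergyOn`, `mem_szSector_iff_isInSector`, `exists_unit_isInSector`, `neg_sum_norm_le_re_expect`,
`Model.energy`, `Model.hamiltonian(_isHermitian)`, `Hamiltonians.hubbardRingTV(_isSymmetric)`,
`szSector_upDown_ne_bot`, `concaveOn_minEnergyOn_pencil` (`QuantumLattice/GriffithsLemmaGroundStates`);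
`concaveOn_pqgSectorEnergy_line`, `concaveOn_pqgSingletEnergy_line` (`Rows/RelaxationValueConcavity`).
Mathlib: `ConcaveOn`, `le_csInf`, `csInf_le`.
-/

noncomputable section

namespace Summit.Ventures.CertifiedQuantumChemistry

open Matrix Finset
open Literature.MathematicalPhysics.QuantumLattice Literature.MathematicalPhysics.QuantumChemistry
open scoped ComplexOrder

/-! ### §1 The second-quantised map is linear in the tables -/

section Linear

variable {Λ : Type*} [LinearOrder Λ] [Fintype Λ]
variable (h₀ h₁ : Λ → Λ → ℂ) (g₀ g₁ : Λ → Λ → Λ → Λ → ℂ) (c₀ c₁ : ℂ)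

/-- **`Ĥ(T₀ + sT₁) = Ĥ(T₀) + s·Ĥ(T₁)`**: the molecular Hamiltonian is linear in `(h, g, h_nuc)`. -/
theorem molecularHamiltonian_line (s : ℂ) :
    molecularHamiltonian (h₀ + s • h₁) (g₀ + s • g₁) (c₀ + s * c₁) =
      molecularHamiltonian h₀ g₀ c₀ + s • molecularHamiltonian h₁ g₁ c₁ := by
  unfold molecularHamiltonian
  simp only [Pi.add_apply, Pi.smul_apply, smul_eq_mul, add_smul, Finset.sum_add_distrib, smul_add,
    Finset.smul_sum, smul_smul]
  have e1 : ∀ p q r u : Λ, (1 / 2 : ℂ) * (s * g₁ p q r u) = s * ((1 / 2 : ℂ) * g₁ p q r u) := by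
    intros; ring
  simp only [e1, mul_comm s c₁]
  abel

end Linear

/-! ### §2 Concavity and Lipschitz continuity of `minEnergyOn` in the operator -/

section MinEnergy

variable {κ : Type*} [LinearOrder κ] [Fintype κ]

omit [LinearOrder κ] in
/-- The Rayleigh quotient of `H₀ + sH₁` in a vector, real `s`: `Re⟨ψ,(H₀ + sH₁)ψ⟩ = Re⟨ψ,H₀ψ⟩ + s Re⟨ψ,H₁ψ⟩`. -/
private theorem re_expect_line (H₀ H₁ : Matrix (Finset κ) (Finset κ) ℂ) (s : ℝ) (ψ : Fock κ) :
    (star ψ ⬝ᵥ (H₀ + (s : ℂ) • H₁) *ᵥ ψ).re =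
      (star ψ ⬝ᵥ H₀ *ᵥ ψ).re + s * (star ψ ⬝ᵥ H₁ *ᵥ ψ).re := by
  rw [Matrix.add_mulVec, Matrix.smul_mulVec, dotProduct_add, dotProduct_smul, Complex.add_re,
    smul_eq_mul, Complex.re_ofReal_mul]

/-- The Rayleigh quotients of `H` on unit vectors are bounded below by `−Σ‖H_st‖`. -/
private theorem bddBelow_rayleighSet_fock (H : Matrix (Finset κ) (Finset κ) ℂ) (K : Submodule ℂ (Fock κ)) :
    BddBelow {E : ℝ | ∃ ψ ∈ K, star ψ ⬝ᵥ ψ = 1 ∧ E = (star ψ ⬝ᵥ H *ᵥ ψ).re} := by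
  refine ⟨-(∑ s, ∑ t, ‖H s t‖), ?_⟩
  rintro E ⟨ψ, -, hψ1, rfl⟩
  exact neg_sum_norm_le_re_expect H hψ1

/-- **The variational minimum over a fixed subspace is CONCAVE along lines in operator space**: for any
subspace `K` with a unit vector, `s ↦ minEnergyOn (H₀ + sH₁) K` is concave on `ℝ` (infimum of the affine
functions `s ↦ Re⟨ψ,(H₀ + sH₁)ψ⟩`). The tree's `concaveOn_minEnergyOn_pencil` (Griffiths-lemma file) is
the same statement for HERMITIAN `H₀, H₁`; the infimum-of-affine argument needs no Hermiticity, which is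
what the table-line form below (arbitrary complex tables, as in `Rows/RelaxationValueConcavity`) uses. -/
theorem concaveOn_minEnergyOn_line (H₀ H₁ : Matrix (Finset κ) (Finset κ) ℂ) (K : Submodule ℂ (Fock κ))
    (hK : ∃ ψ ∈ K, star ψ ⬝ᵥ ψ = 1) :
    ConcaveOn ℝ Set.univ fun s : ℝ => (H₀ + (s : ℂ) • H₁).minEnergyOn K := by
  refine ⟨convex_univ, fun s _ s' _ a b ha hb hab => ?_⟩
  dsimp only
  unfold Matrix.minEnergyOn
  have hne : ∀ H : Matrix (Finset κ) (Finset κ) ℂ,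
      {E : ℝ | ∃ ψ ∈ K, star ψ ⬝ᵥ ψ = 1 ∧ E = (star ψ ⬝ᵥ H *ᵥ ψ).re}.Nonempty := fun H => by
    obtain ⟨ψ, hψK, hψ1⟩ := hK
    exact ⟨_, ψ, hψK, hψ1, rfl⟩
  refine le_csInf (hne _) ?_
  rintro E ⟨ψ, hψK, hψ1, rfl⟩
  have h1 := csInf_le (bddBelow_rayleighSet_fock (H₀ + (s : ℂ) • H₁) K) ⟨ψ, hψK, hψ1, rfl⟩
  have h2 := csInf_le (bddBelow_rayleighSet_fock (H₀ + (s' : ℂ) • H₁) K) ⟨ψ, hψK, hψ1, rfl⟩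
  rw [re_expect_line] at h1 h2
  simp only [smul_eq_mul]
  rw [show (((a * s + b * s' : ℝ)) : ℂ) = ((a * s + b * s' : ℝ) : ℂ) from rfl, re_expect_line]
  set e₀ := (star ψ ⬝ᵥ H₀ *ᵥ ψ).re
  set e₁ := (star ψ ⬝ᵥ H₁ *ᵥ ψ).re
  have ha1 := mul_le_mul_of_nonneg_left h1 ha
  have hb2 := mul_le_mul_of_nonneg_left h2 hb
  have key : a * (e₀ + s * e₁) + b * (e₀ + s' * e₁) = e₀ + (a * s + b * s') * e₁ := by
    calc a * (e₀ + s * e₁) + b * (e₀ + s' * e₁) = (a + b) * e₀ + (a * s + b * s') * e₁ := by ring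
      _ = e₀ + (a * s + b * s') * e₁ := by rw [hab, one_mul]
  linarith

/-- **Lipschitz dependence of the variational minimum on the operator**:
`|minEnergyOn H K − minEnergyOn H′ K| ≤ Σ_st ‖H_st − H′_st‖` for any subspace `K` with a unit vector. -/
theorem abs_minEnergyOn_sub_le (H H' : Matrix (Finset κ) (Finset κ) ℂ) (K : Submodule ℂ (Fock κ))
    (hK : ∃ ψ ∈ K, star ψ ⬝ᵥ ψ = 1) :
    |H.minEnergyOn K - H'.minEnergyOn K| ≤ ∑ s, ∑ t, ‖H s t - H' s t‖ := by
  unfold Matrix.minEnergyOn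
  set B := ∑ s, ∑ t, ‖H s t - H' s t‖
  have hne : ∀ M : Matrix (Finset κ) (Finset κ) ℂ,
      {E : ℝ | ∃ ψ ∈ K, star ψ ⬝ᵥ ψ = 1 ∧ E = (star ψ ⬝ᵥ M *ᵥ ψ).re}.Nonempty := fun M => by
    obtain ⟨ψ, hψK, hψ1⟩ := hK
    exact ⟨_, ψ, hψK, hψ1, rfl⟩
  -- pointwise: `|Re⟨ψ,Hψ⟩ − Re⟨ψ,H'ψ⟩| ≤ B`
  have hpt : ∀ ψ : Fock κ, star ψ ⬝ᵥ ψ = 1 →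
      |(star ψ ⬝ᵥ H *ᵥ ψ).re - (star ψ ⬝ᵥ H' *ᵥ ψ).re| ≤ B := by
    intro ψ hψ1
    have hsub : (star ψ ⬝ᵥ H *ᵥ ψ).re - (star ψ ⬝ᵥ H' *ᵥ ψ).re = (star ψ ⬝ᵥ (H - H') *ᵥ ψ).re := by
      rw [Matrix.sub_mulVec, dotProduct_sub, Complex.sub_re]
    rw [hsub, abs_le]
    constructor
    · exact neg_sum_norm_le_re_expect (H - H') hψ1
    · have h2 := neg_sum_norm_le_re_expect (H' - H) hψ1
      have hneg : (star ψ ⬝ᵥ (H' - H) *ᵥ ψ).re = -(star ψ ⬝ᵥ (H - H') *ᵥ ψ).re := by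
        rw [← Complex.neg_re, ← dotProduct_neg, ← Matrix.neg_mulVec, neg_sub]
      have hB' : ∑ s, ∑ t, ‖(H' - H) s t‖ = B := by
        refine Finset.sum_congr rfl fun s _ => Finset.sum_congr rfl fun t _ => ?_
        exact norm_sub_rev _ _
      have : (Literature.MathematicalPhysics.QuantumLattice.expect (H' - H) ψ).re =
          (star ψ ⬝ᵥ (H' - H) *ᵥ ψ).re := rfl
      rw [this, hneg, hB'] at h2
      have hB2 : ∑ s, ∑ t, ‖(H - H') s t‖ = B := rfl
      linarith
  rw [abs_sub_le_iff]
  constructor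
  · rw [sub_le_iff_le_add]
    have : sInf {E : ℝ | ∃ ψ ∈ K, star ψ ⬝ᵥ ψ = 1 ∧ E = (star ψ ⬝ᵥ H *ᵥ ψ).re} - B ≤
        sInf {E : ℝ | ∃ ψ ∈ K, star ψ ⬝ᵥ ψ = 1 ∧ E = (star ψ ⬝ᵥ H' *ᵥ ψ).re} := by
      refine le_csInf (hne _) ?_
      rintro E ⟨ψ, hψK, hψ1, rfl⟩
      have h1 := csInf_le (bddBelow_rayleighSet_fock H K) ⟨ψ, hψK, hψ1, rfl⟩
      have h2 := (abs_sub_le_iff.1 (hpt ψ hψ1)).1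
      linarith
    linarith
  · rw [sub_le_iff_le_add]
    have : sInf {E : ℝ | ∃ ψ ∈ K, star ψ ⬝ᵥ ψ = 1 ∧ E = (star ψ ⬝ᵥ H' *ᵥ ψ).re} - B ≤
        sInf {E : ℝ | ∃ ψ ∈ K, star ψ ⬝ᵥ ψ = 1 ∧ E = (star ψ ⬝ᵥ H *ᵥ ψ).re} := by
      refine le_csInf (hne _) ?_
      rintro E ⟨ψ, hψK, hψ1, rfl⟩
      have h1 := csInf_le (bddBelow_rayleighSet_fock H' K) ⟨ψ, hψK, hψ1, rfl⟩
      have h2 := (abs_sub_le_iff.1 (hpt ψ hψ1)).2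
      linarith
    linarith

end MinEnergy

/-! ### §3 The exact sector energy along lines in table space -/

section Sector

variable {Λ : Type*} [LinearOrder Λ] [Fintype Λ]
variable (h₀ h₁ : Λ → Λ → ℂ) (g₀ g₁ : Λ → Λ → Λ → Λ → ℂ) (c₀ c₁ : ℂ)

/-- A non-trivial sector carries a unit vector (in submodule form). -/
private theorem exists_unit_mem_szSector {a b : ℕ} (ha : a ≤ Fintype.card Λ) (hb : b ≤ Fintype.card Λ) :
    ∃ ψ : Fock (Orb Λ), ψ ∈ szSector (a + b) (((a : ℝ) - b) / 2) ∧ star ψ ⬝ᵥ ψ = (1 : ℂ) := by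
  obtain ⟨ψ, hψ, hψ1⟩ := exists_unit_isInSector (Λ := Λ) ha hb
  exact ⟨ψ, (mem_szSector_iff_isInSector a b ψ).2 hψ, hψ1⟩

/-- **`E₀(Ĥ(T₀ + sT₁); a, b)` is a CONCAVE function of `s`** (`a, b ≤ |Λ|`): the exact sector energy is
an infimum of affine functions of the tables (variational principle). -/
theorem concaveOn_sectorGroundEnergy_line {a b : ℕ} (ha : a ≤ Fintype.card Λ) (hb : b ≤ Fintype.card Λ) :
    ConcaveOn ℝ Set.univ fun s : ℝ =>
      sectorGroundEnergy (molecularHamiltonian (h₀ + (s : ℂ) • h₁) (g₀ + (s : ℂ) • g₁) (c₀ + (s : ℂ) * c₁))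
        a b := by
  have h := concaveOn_minEnergyOn_line (molecularHamiltonian h₀ g₀ c₀) (molecularHamiltonian h₁ g₁ c₁)
    (szSector (a + b) (((a : ℝ) - b) / 2)) (exists_unit_mem_szSector ha hb)
  refine h.congr fun s _ => ?_
  rw [sectorGroundEnergy_def, molecularHamiltonian_line]

/-- **`E₀` is Lipschitz in the operator**: `|E₀(Ĥ; a, b) − E₀(Ĥ′; a, b)| ≤ Σ_st ‖Ĥ_st − Ĥ′_st‖`
(`a, b ≤ |Λ|`). -/
theorem abs_sectorGroundEnergy_sub_le (H H' : Matrix (Finset (Orb Λ)) (Finset (Orb Λ)) ℂ) {a b : ℕ}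
    (ha : a ≤ Fintype.card Λ) (hb : b ≤ Fintype.card Λ) :
    |sectorGroundEnergy H a b - sectorGroundEnergy H' a b| ≤ ∑ s, ∑ t, ‖H s t - H' s t‖ := by
  rw [sectorGroundEnergy_def, sectorGroundEnergy_def]
  exact abs_minEnergyOn_sub_le H H' _ (exists_unit_mem_szSector ha hb)

end Sector

/-! ### §4 The Hubbard-ring files: `E₀(L;U)`, `OPT_DQG(L;U)`, `OPT_DQG+S²(L;U)` are concave in `U` -/

section Hubbard

variable (L : ℕ) (t : ℚ)

/-- **The TV-H ring's one-electron table is a pencil in `U`**: `h(t, U) = h(t, 0) + U·h(0, 1)` (cast to `ℂ`;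
`h(0, 1) = 0`). -/
theorem hubbardRingTV_h_pencil (U : ℚ) :
    (fun p q => ((Hamiltonians.hubbardRingTV L t U).h p q : ℂ)) =
      (fun p q => ((Hamiltonians.hubbardRingTV L t 0).h p q : ℂ)) +
        ((U : ℝ) : ℂ) • fun p q => ((Hamiltonians.hubbardRingTV L 0 1).h p q : ℂ) := by
  funext p q
  simp only [Hamiltonians.hubbardRingTV, Pi.add_apply, Pi.smul_apply, smul_eq_mul]
  split_ifs <;> push_cast <;> ring

/-- **The TV-H ring's two-electron table is a pencil in `U`**: `(pq|rs)(t, U) = (pq|rs)(t, 0) + U·(pq|rs)(0, 1)`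
(`(pq|rs)(t, 0) = 0`, `(pp|pp)(0, 1) = 1`). -/
theorem hubbardRingTV_eri_pencil (U : ℚ) :
    (fun p q r s => ((Hamiltonians.hubbardRingTV L t U).eri p q r s : ℂ)) =
      (fun p q r s => ((Hamiltonians.hubbardRingTV L t 0).eri p q r s : ℂ)) +
        ((U : ℝ) : ℂ) • fun p q r s => ((Hamiltonians.hubbardRingTV L 0 1).eri p q r s : ℂ) := by
  funext p q r s
  simp only [Hamiltonians.hubbardRingTV, Pi.add_apply, Pi.smul_apply, smul_eq_mul, Complex.ofReal_ratCast]
  split_ifs <;> push_cast <;> ring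

/-- The constants: `0 = 0 + U·0`. -/
theorem hubbardRingTV_ecore_pencil (U : ℚ) :
    ((Hamiltonians.hubbardRingTV L t U).ecore : ℂ) =
      ((Hamiltonians.hubbardRingTV L t 0).ecore : ℂ) + ((U : ℝ) : ℂ) * ((Hamiltonians.hubbardRingTV L 0 1).ecore : ℂ) := by
  simp [Hamiltonians.hubbardRingTV]

/-- **THE HUBBARD-RING HAMILTONIAN IS A PENCIL IN `U`**: `Ĥ(L; t, U) = Ĥ(L; t, 0) + U·Ĥ(L; 0, 1)` (hopping part
plus `U` times the on-site repulsion `Σ_p n_{p↑} n_{p↓}` written as the `t = 0, U = 1` model). -/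
theorem hubbardRingTV_hamiltonian_pencil (U : ℚ) :
    (Hamiltonians.hubbardRingTV L t U).hamiltonian =
      (Hamiltonians.hubbardRingTV L t 0).hamiltonian + ((U : ℝ) : ℂ) • (Hamiltonians.hubbardRingTV L 0 1).hamiltonian := by
  simp only [Model.hamiltonian]
  rw [hubbardRingTV_h_pencil, hubbardRingTV_eri_pencil, hubbardRingTV_ecore_pencil, molecularHamiltonian_line]

/-- **`E₀(L; t, U; a, b)` is the value at `s = U` of `s ↦ minEnergyOn (Ĥ(t,0) + s·Ĥ(0,1))` on the sector.** -/
theorem hubbardRingTV_energy_eq_pencil (U : ℚ) (a b : ℕ) :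
    (Hamiltonians.hubbardRingTV L t U).energy a b =
      ((Hamiltonians.hubbardRingTV L t 0).hamiltonian +
          ((U : ℝ) : ℂ) • (Hamiltonians.hubbardRingTV L 0 1).hamiltonian).minEnergyOn
        (szSector (a + b) (((a : ℝ) - b) / 2)) := by
  rw [Model.energy, sectorGroundEnergy_def, hubbardRingTV_hamiltonian_pencil]

/-- **`U ↦ E₀(L; t, U; a, b)` IS CONCAVE** (`a, b ≤ L`): the exact sector energy of the TV-H Hubbard ring
along the real pencil `Ĥ(t,0) + s·Ĥ(0,1)` is concave in `s` — the tree's `concaveOn_minEnergyOn_pencil`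
(Griffiths) on two Hermitian model Hamiltonians; the model's `energy` at rational `U` is its value at
`s = U` (`hubbardRingTV_energy_eq_pencil`). -/
theorem concaveOn_hubbardRing_energy {a b : ℕ} (ha : a ≤ L) (hb : b ≤ L) :
    ConcaveOn ℝ Set.univ fun s : ℝ =>
      ((Hamiltonians.hubbardRingTV L t 0).hamiltonian +
          (s : ℂ) • (Hamiltonians.hubbardRingTV L 0 1).hamiltonian).minEnergyOn
        (szSector (a + b) (((a : ℝ) - b) / 2)) :=
  concaveOn_minEnergyOn_pencil
    (Model.hamiltonian_isHermitian (Hamiltonians.hubbardRingTV_isSymmetric L t 0))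
    (Model.hamiltonian_isHermitian (Hamiltonians.hubbardRingTV_isSymmetric L 0 1))
    (szSector_upDown_ne_bot (by rwa [Fintype.card_fin]) (by rwa [Fintype.card_fin]))

/-- **`U ↦ E₀(L; t, U; a, b)` is Lipschitz**: `|E₀(U) − E₀(U′)| ≤ |U − U′| · Σ_st ‖Ĥ(L; 0, 1)_st‖`. -/
theorem abs_hubbardRing_energy_sub_le {a b : ℕ} (ha : a ≤ L) (hb : b ≤ L) (U U' : ℚ) :
    |(Hamiltonians.hubbardRingTV L t U).energy a b - (Hamiltonians.hubbardRingTV L t U').energy a b| ≤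
      |(U : ℝ) - U'| * ∑ x, ∑ y, ‖(Hamiltonians.hubbardRingTV L 0 1).hamiltonian x y‖ := by
  rw [hubbardRingTV_energy_eq_pencil, hubbardRingTV_energy_eq_pencil]
  refine (abs_minEnergyOn_sub_le _ _ _ (exists_unit_mem_szSector (Λ := Fin L)
    (by rwa [Fintype.card_fin]) (by rwa [Fintype.card_fin]))).trans (le_of_eq ?_)
  rw [Finset.mul_sum]
  refine Finset.sum_congr rfl fun x _ => ?_
  rw [Finset.mul_sum]
  refine Finset.sum_congr rfl fun y _ => ?_
  rw [Matrix.add_apply, Matrix.add_apply, Matrix.smul_apply, Matrix.smul_apply, add_sub_add_left_eq_sub,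
    smul_eq_mul, smul_eq_mul, ← sub_mul, norm_mul, ← Complex.ofReal_sub, Complex.norm_real, Real.norm_eq_abs]

/-- **`U ↦ OPT_DQG(L; t, U; a, b)` IS CONCAVE**: the `S_z`-sector DQG value of the TV-H ring's tables along
the pencil `T(t,0) + s·T(0,1)` (the cell's `DQG` instances on these files at `s = U`; STRUCTURE §2.3) is
concave in real `s` (`a, b ≤ L`). -/
theorem concaveOn_hubbardRing_pqgSectorEnergy {a b : ℕ} (ha : a ≤ L) (hb : b ≤ L) :
    ConcaveOn ℝ Set.univ fun s : ℝ =>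
      pqgSectorEnergy
        ((fun p q => ((Hamiltonians.hubbardRingTV L t 0).h p q : ℂ)) +
          (s : ℂ) • fun p q => ((Hamiltonians.hubbardRingTV L 0 1).h p q : ℂ))
        ((fun p q r u => ((Hamiltonians.hubbardRingTV L t 0).eri p q r u : ℂ)) +
          (s : ℂ) • fun p q r u => ((Hamiltonians.hubbardRingTV L 0 1).eri p q r u : ℂ))
        (((Hamiltonians.hubbardRingTV L t 0).ecore : ℂ) + (s : ℂ) * ((Hamiltonians.hubbardRingTV L 0 1).ecore : ℂ))
        a b :=
  concaveOn_pqgSectorEnergy_line _ _ _ _ _ _ (by rwa [Fintype.card_fin]) (by rwa [Fintype.card_fin])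

/-- **`U ↦ OPT_DQG+S²(L; t, U; 2n, S = 0)` IS CONCAVE**: the singlet-restricted DQG value (the cell's
`DQG+S²` instances) along the same pencil is concave in real `s` (`n ≤ L`). -/
theorem concaveOn_hubbardRing_pqgSingletEnergy {n : ℕ} (hn : n ≤ L) :
    ConcaveOn ℝ Set.univ fun s : ℝ =>
      pqgSingletEnergy
        ((fun p q => ((Hamiltonians.hubbardRingTV L t 0).h p q : ℂ)) +
          (s : ℂ) • fun p q => ((Hamiltonians.hubbardRingTV L 0 1).h p q : ℂ))
        ((fun p q r u => ((Hamiltonians.hubbardRingTV L t 0).eri p q r u : ℂ)) +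
          (s : ℂ) • fun p q r u => ((Hamiltonians.hubbardRingTV L 0 1).eri p q r u : ℂ))
        (((Hamiltonians.hubbardRingTV L t 0).ecore : ℂ) + (s : ℂ) * ((Hamiltonians.hubbardRingTV L 0 1).ecore : ℂ))
        n :=
  concaveOn_pqgSingletEnergy_line _ _ _ _ _ _ (by rwa [Fintype.card_fin])

/-- **The cell's tables at rational `U` are the pencil's tables at `s = U`** (so the `OPT` columns of
STRUCTURE §1A are restrictions to `ℚ` of the two concave functions above). -/
theorem hubbardRingTV_tables_pencil (U : ℚ) :
    (fun p q => ((Hamiltonians.hubbardRingTV L t U).h p q : ℂ)) =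
        (fun p q => ((Hamiltonians.hubbardRingTV L t 0).h p q : ℂ)) +
          ((U : ℝ) : ℂ) • (fun p q => ((Hamiltonians.hubbardRingTV L 0 1).h p q : ℂ)) ∧
      (fun p q r s => ((Hamiltonians.hubbardRingTV L t U).eri p q r s : ℂ)) =
        (fun p q r s => ((Hamiltonians.hubbardRingTV L t 0).eri p q r s : ℂ)) +
          ((U : ℝ) : ℂ) • (fun p q r s => ((Hamiltonians.hubbardRingTV L 0 1).eri p q r s : ℂ)) ∧
      ((Hamiltonians.hubbardRingTV L t U).ecore : ℂ) =
        ((Hamiltonians.hubbardRingTV L t 0).ecore : ℂ) +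
          ((U : ℝ) : ℂ) * ((Hamiltonians.hubbardRingTV L 0 1).ecore : ℂ) :=
  ⟨hubbardRingTV_h_pencil L t U, hubbardRingTV_eri_pencil L t U, hubbardRingTV_ecore_pencil L t U⟩

end Hubbard

end Summit.Ventures.CertifiedQuantumChemistry

end
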